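import Literature.Probability.Percolation.TrackExchangeStrip
import Literature.Probability.Percolation.StarTriangleKernels
import Literature.Probability.Percolation.RandomMapChains
import Literature.Probability.LatticeModels.ProdBernoulliResample
import HarnessLib

/-!
# Track exchange in a strip: one sweep `Σ_j` as a chain of random maps, and its law

Grimmett–Manolescu, *Bond percolation on isoradial graphs* (PTRF 159 (2014) 273–327 =
arXiv:1204.0505), §5.3: "Let `ω` be an edge-configuration of `G`, and assign a random state to
the new 'green' edge with the distribution appropriate to the isoradial embedding. The
star–triangle transformations used in `Σ_j` are independent applications of the kernels `T` and
`S` […]. The ensuing configuration on `Σ_j(G)` is written `Σ_j(ω)`. Thus `Σ_j` is a random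
operator on `ω`, with randomness stemming from the extra edge and the star–triangle
transformations", and `Σ_j(G_{α,β}, P_{α,β}) = (G_{α,σ_jβ}, P_{α,σ_jβ})`.

This file realises `Σ_j` on the strip of `Literature.Probability.Percolation.TrackExchangeStrip`
(`D : ExchangeData`: half-width `M`, column angles `α`, row angles `β`, level `j`, direction
`β_j > β_{j-1}`) as a deterministic function of the configuration and of `1 + 2M` independent
uniform variables, every step being one of the measure-transporting maps already in the tree:

* `ExchangeData.insertStep` — the green edge: `resample` (`ProdBernoulliResample`) of the new
  edge `B_{-M}T_{-M}` (odd case) or, after renaming `O_{-M}` to `⋆`, of the pendant edge `⋆N_{-M}`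
  (even case); `map_insertStep`: `P_{initial} ⊗ U ↦ P_{stage (-M)}` (`oddStage_neg`,
  `evenStage_neg`).
* `ExchangeData.sStep i₀` (even stage: the star → triangle map `sMove` of `StarTriangleKernels` at
  `⋆ = O_{i₀}`), `ExchangeData.tStep i₀` (odd stage: the triangle → star map `tMove` at
  `(B_{i₀}, O_{i₀+1}, T_{i₀})` followed by the relabelling `swapMid (i₀+1)`),
  `ExchangeData.moveStep`; `map_sStep`, `map_tStep`, `map_moveStep`:
  `P_{stage i₀} ⊗ U ↦ P_{stage (i₀+1)}` for `-M ≤ i₀ < M` (`map_sMove`/`map_tMove` with the side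
  conditions `κ_△ = 0`, `0 < p < 1` of `TrackExchangeStrip`, `evenStage_eq_afterMove`,
  `afterMove_oddStage`, `prodBernoulli_map_image_of_comp_eq`).
* `ExchangeData.slide` — the `2M` moves as a `RandomMapChain.run`; `map_slide`:
  `P_{stage (-M)} ⊗ U^{⊗ 2M} ↦ P_{stage M}`.
* `ExchangeData.removeStep` — removal of the travelling edge at the right side; `map_removeStep`:
  `P_{stage M} ↦ P_{exchanged}` (`update_oddStage_M`, `update_evenStage_M`,
  `prodBernoulli_map_sdiff_singleton`).
* `ExchangeData.sweep` = removal ∘ slide ∘ insertion, driven by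
  `r : [0,1] × ([0,1]^{2M})`; **`map_sweep`**: under `P_{α,β} ⊗ (U ⊗ U^{⊗ 2M})` the swept
  configuration has law `P_{α,σ_jβ}` on the strip — GM14's display
  `Σ_j(G_{α,β}, P_{α,β}) = (G_{α,σ_jβ}, P_{α,σ_jβ})`.

All statements are under `ExchangeData.Valid` (the bounded-angles inequalities
`β_j - β_{j-1}, β_{j-1} - α_i, β_j - α_i ∈ (0, π)` on the strip), and are proved; no
probabilistic input beyond the tree's coupling lemmas is used. The pathwise transport of open
paths (GM14 §6.2) is the business of the next file.

## References

* G. R. Grimmett, I. Manolescu, PTRF 159 (2014) 273–327, arXiv:1204.0505, §5.3 (the random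
  operator `Σ_j`), §6.2 (the law `P` of the configuration chain).
* G. R. Grimmett, I. Manolescu, Ann. Probab. 41 (2013) 2990–3025, arXiv:1105.5535, Prop. 2.2
  (the kernels `T`, `S`).
-/

noncomputable section

namespace Literature.Probability.Percolation

open LatticeModels StarTriangle Real MeasureTheory

namespace TrackExchange

namespace ExchangeData

variable (D : ExchangeData)

/-- The bounded-angles hypotheses under which `Σ_j` sweeps from left to right through the strip:
`0 < β_j - β_{j-1} < π` and, for every column `i` of the strip, `β_{j-1} - α_i`, `β_j - α_i ∈
(0, π)` (GM14 §5.3 "Assume `β_j > β_{j-1}`" and BAC(ε)). [cite: GrimmettManolescu2014Isoradial, §5.3] -/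
structure Valid : Prop where
  /-- The direction of the sweep. -/
  lu : D.up - D.lo ∈ Set.Ioo 0 π
  /-- Bounded angles, lower track. -/
  lo : ∀ i : ℤ, -(D.M : ℤ) ≤ i → i < D.M → D.lo - D.α i ∈ Set.Ioo 0 π
  /-- Bounded angles, upper track. -/
  up : ∀ i : ℤ, -(D.M : ℤ) ≤ i → i < D.M → D.up - D.α i ∈ Set.Ioo 0 π

/-! ### The atomic moves -/

/-- **The move at an even stage `i₀`**: the star → triangle map `S` at `⋆ = O_{i₀}` with triangle
`(N_{i₀}, B_{i₀+1}, T_{i₀+1})`, driven by the uniform variable `u`.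
[cite: GrimmettManolescu2014Isoradial, §5.3] -/
def sStep (i₀ : ℤ) (ω : Set (Sym2 SV)) (u : unitInterval) : Set (Sym2 SV) :=
  sMove (D.oddStage (i₀ + 1)) (triEdge (D.evenTri i₀)) (starEdge (D.evenTri i₀) none) ω u

/-- **The move at an odd stage `i₀`**: the triangle → star map `T` at `(B_{i₀}, O_{i₀+1}, T_{i₀})`
(the new centre being born as `⋆`), followed by the exchange of the labels `⋆` and `(i₀+1, j)`.
[cite: GrimmettManolescu2014Isoradial, §5.3] -/
def tStep (i₀ : ℤ) (ω : Set (Sym2 SV)) (u : unitInterval) : Set (Sym2 SV) :=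
  sym2Equiv (D.swapMid (i₀ + 1)) ''
    tMove (D.oddStage i₀) (triEdge (D.oddTri i₀)) (starEdge (D.oddTri i₀) none) ω u

/-- The move from stage `i₀` to stage `i₀ + 1`. [cite: GrimmettManolescu2014Isoradial, §5.3] -/
def moveStep (i₀ : ℤ) (ω : Set (Sym2 SV)) (u : unitInterval) : Set (Sym2 SV) :=
  if Even (i₀ + D.j) then D.sStep i₀ ω u else D.tStep i₀ ω u

/-- The even-stage move is jointly measurable. [folklore] -/
theorem measurable_sStep (i₀ : ℤ) : Measurable (Function.uncurry (D.sStep i₀)) :=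
  measurable_sMove

/-- The odd-stage move is jointly measurable. [folklore] -/
theorem measurable_tStep (i₀ : ℤ) : Measurable (Function.uncurry (D.tStep i₀)) :=
  (measurable_image_equiv _).comp measurable_tMove

/-- Every move is jointly measurable. [folklore] -/
theorem measurable_moveStep (i₀ : ℤ) : Measurable (Function.uncurry (D.moveStep i₀)) := by
  unfold moveStep
  split_ifs
  · exact D.measurable_sStep i₀
  · exact D.measurable_tStep i₀

variable {D}

/-- The three weights of the even-stage triangle are positive. [cite: GrimmettManolescu2014Isoradial, §2.2 (2.1)] -/
theorem oddStage_succ_triEdge_pos (hV : D.Valid) {i₀ : ℤ} (hi : -(D.M : ℤ) ≤ i₀) (hi' : i₀ < D.M)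
    (hpar : Even (i₀ + D.j)) (k : Fin 3) : 0 < (D.oddStage (i₀ + 1) (triEdge (D.evenTri i₀) k) : ℝ) := by
  have hlu := hV.lu; have hlo := hV.lo i₀ hi hi'; have hup := hV.up i₀ hi hi'
  fin_cases k
  · exact (coe_angleWeight_pos (θ := π - (D.up - D.lo)) ⟨by linarith [hlu.2], by linarith [hlu.1]⟩).trans_eq
      (congrArg Subtype.val (oddStage_succ_triEdge_zero hi hi')).symm
  · exact (coe_angleWeight_pos (θ := π - (D.lo - D.α i₀)) ⟨by linarith [hlo.2], by linarith [hlo.1]⟩).trans_eq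
      (congrArg Subtype.val (oddStage_succ_triEdge_one hpar hi hi')).symm
  · exact (coe_angleWeight_pos hup).trans_eq (congrArg Subtype.val (oddStage_succ_triEdge_two hpar hi hi')).symm

/-- The three weights of the odd-stage triangle are positive. [cite: GrimmettManolescu2014Isoradial, §2.2 (2.1)] -/
theorem oddStage_triEdge_pos (hV : D.Valid) {i₀ : ℤ} (hi : -(D.M : ℤ) ≤ i₀) (hi' : i₀ < D.M)
    (hpar : ¬ Even (i₀ + D.j)) (k : Fin 3) : 0 < (D.oddStage i₀ (triEdge (D.oddTri i₀) k) : ℝ) := by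
  have hlu := hV.lu; have hlo := hV.lo i₀ hi hi'; have hup := hV.up i₀ hi hi'
  fin_cases k
  · exact (coe_angleWeight_pos hup).trans_eq (congrArg Subtype.val (oddStage_triEdge_zero hpar hi hi')).symm
  · exact (coe_angleWeight_pos (θ := π - (D.up - D.lo)) ⟨by linarith [hlu.2], by linarith [hlu.1]⟩).trans_eq
      (congrArg Subtype.val (oddStage_triEdge_one hi hi')).symm
  · exact (coe_angleWeight_pos (θ := π - (D.lo - D.α i₀)) ⟨by linarith [hlo.2], by linarith [hlo.1]⟩).trans_eq
      (congrArg Subtype.val (oddStage_triEdge_two hpar hi hi')).symm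

/-! ### The laws of the moves -/

/-- **The even-stage move transports `P_{stage i₀}` to `P_{stage (i₀+1)}`** (GM13 Prop. 2.2(b)
for the star at `O_{i₀}`: the even stage *is* `afterMove` of the next odd stage,
`evenStage_eq_afterMove`). [cite: GrimmettManolescu2014Isoradial, §5.3] -/
theorem map_sStep (hV : D.Valid) {i₀ : ℤ} (hpar : Even (i₀ + D.j)) (hi : -(D.M : ℤ) ≤ i₀) (hi' : i₀ < D.M) :
    ((prodBernoulli (D.evenStage i₀)).prod (volume : Measure unitInterval)).map (Function.uncurry (D.sStep i₀)) =
      prodBernoulli (D.oddStage (i₀ + 1)) := by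
  have hv := evenTri_injective (D := D) i₀
  have hvO := evenTri_ne_none (D := D) i₀
  have hlo := hV.lo i₀ hi hi'; have hup := hV.up i₀ hi hi'
  have hq := evenStage_eq_afterMove hpar hi hi' hV.lu hlo hup
  refine map_sMove (triEdge_injective hv) (starEdge_injective hv hvO) (fun j k => starEdge_ne_triEdge hvO j k)
    (fun k => oddStage_eq_zero_of_mem_none _ (Sym2.mem_mk_left _ _)) (q := D.evenStage i₀) ?_ ?_ ?_ ?_ ?_ ?_
  · intro k; rw [hq]; exact afterMove_triEdge _ _ _ k
  · intro k; rw [hq]; exact coe_afterMove_starEdge hv hvO _ k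
  · intro e h1 h2; rw [hq]; exact afterMove_of_ne _ h1 h2
  · exact kappa_oddStage_succ_evenTri hpar hi hi' hV.lu hlo hup
  · exact oddStage_succ_triEdge_pos hV hi hi' hpar
  · exact oddStage_succ_triEdge_lt_one hpar hi hi' hV.lu hlo hup

/-- **The odd-stage move transports `P_{stage i₀}` to `P_{stage (i₀+1)}`** (GM13 Prop. 2.2(a)
for the triangle `(B_{i₀}, O_{i₀+1}, T_{i₀})`, then the relabelling: `afterMove_oddStage` and
`prodBernoulli_map_image_of_comp_eq`). [cite: GrimmettManolescu2014Isoradial, §5.3] -/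
theorem map_tStep (hV : D.Valid) {i₀ : ℤ} (hpar : ¬ Even (i₀ + D.j)) (hi : -(D.M : ℤ) ≤ i₀) (hi' : i₀ < D.M) :
    ((prodBernoulli (D.oddStage i₀)).prod (volume : Measure unitInterval)).map (Function.uncurry (D.tStep i₀)) =
      prodBernoulli (D.evenStage (i₀ + 1)) := by
  have hv := oddTri_injective (D := D) i₀
  have hvO := oddTri_ne_none (D := D) i₀
  have hlo := hV.lo i₀ hi hi'; have hup := hV.up i₀ hi hi'
  have h1 : Function.uncurry (D.tStep i₀) = (fun s => sym2Equiv (D.swapMid (i₀ + 1)) '' s) ∘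
      (fun x : Set (Sym2 SV) × unitInterval =>
        tMove (D.oddStage i₀) (triEdge (D.oddTri i₀)) (starEdge (D.oddTri i₀) none) x.1 x.2) := rfl
  rw [h1, ← Measure.map_map (measurable_image_equiv _) measurable_tMove,
    map_tMove (triEdge_injective hv) (starEdge_injective hv hvO) (fun j k => starEdge_ne_triEdge hvO j k)
      (fun k => oddStage_eq_zero_of_mem_none _ (Sym2.mem_mk_left _ _))
      (q := afterMove (D.oddStage i₀) (D.oddTri i₀) none)
      (fun k => afterMove_triEdge _ _ _ k) (fun k => coe_afterMove_starEdge hv hvO _ k)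
      (fun e h1 h2 => afterMove_of_ne _ h1 h2)
      (kappa_oddStage_oddTri hpar hi hi' hV.lu hlo hup) (oddStage_triEdge_lt_one hpar hi hi' hV.lu hlo hup)]
  exact prodBernoulli_map_image_of_comp_eq _ _ (sym2Equiv (D.swapMid (i₀ + 1))) fun e =>
    (afterMove_oddStage hpar hi hi' hV.lu hlo hup e).symm

/-- Parity of consecutive stages. [folklore] -/
theorem even_succ_add_iff (i₀ : ℤ) : Even (i₀ + 1 + D.j) ↔ ¬ Even (i₀ + D.j) := by
  rw [show i₀ + 1 + D.j = i₀ + D.j + 1 by ring, Int.even_add_one]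

/-- **Each move transports the law of its stage to the law of the next stage.**
[cite: GrimmettManolescu2014Isoradial, §5.3] -/
theorem map_moveStep (hV : D.Valid) {i₀ : ℤ} (hi : -(D.M : ℤ) ≤ i₀) (hi' : i₀ < D.M) :
    ((prodBernoulli (D.stage i₀)).prod (volume : Measure unitInterval)).map (Function.uncurry (D.moveStep i₀)) =
      prodBernoulli (D.stage (i₀ + 1)) := by
  unfold stage moveStep
  by_cases hpar : Even (i₀ + D.j)
  · have hpar' : ¬ Even (i₀ + 1 + D.j) := fun h => (even_succ_add_iff i₀).1 h hpar
    simp only [hpar, hpar', if_true, if_false]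
    exact map_sStep hV hpar hi hi'
  · have hpar' : Even (i₀ + 1 + D.j) := (even_succ_add_iff i₀).2 hpar
    simp only [hpar, hpar', if_true, if_false]
    exact map_tStep hV hpar hi hi'

/-! ### Sliding the rhombus through the strip -/

variable (D)

/-- The `2M` moves of the sweep, indexed by `t = i₀ + M`. [cite: GrimmettManolescu2014Isoradial, §5.3] -/
def sweepMoves : Fin (2 * D.M) → Set (Sym2 SV) → unitInterval → Set (Sym2 SV) :=
  fun t => D.moveStep (-(D.M : ℤ) + t)

/-- **Sliding**: the `2M` moves from stage `-M` to stage `M`, driven by `2M` uniform variables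
("By repeated star–triangle transformations, we 'slide' the new rhombus along the two tracks
from left to right"). [cite: GrimmettManolescu2014Isoradial, §5.3] -/
def slide (ω : Set (Sym2 SV)) (u : Fin (2 * D.M) → unitInterval) : Set (Sym2 SV) :=
  RandomMapChain.run (2 * D.M) D.sweepMoves ω u

/-- Sliding is jointly measurable. [folklore] -/
theorem measurable_slide : Measurable fun x : Set (Sym2 SV) × (Fin (2 * D.M) → unitInterval) => D.slide x.1 x.2 :=
  RandomMapChain.measurable_run _ _ fun _ => D.measurable_moveStep _

variable {D}

/-- **The law after sliding**: `P_{stage (-M)} ⊗ U^{⊗ 2M} ↦ P_{stage M}`. [cite: GrimmettManolescu2014Isoradial, §5.3] -/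
theorem map_slide (hV : D.Valid) :
    ((prodBernoulli (D.stage (-(D.M : ℤ)))).prod
        (Measure.pi fun _ : Fin (2 * D.M) => (volume : Measure unitInterval))).map
      (fun x : Set (Sym2 SV) × (Fin (2 * D.M) → unitInterval) => D.slide x.1 x.2) =
      prodBernoulli (D.stage D.M) := by
  have h := RandomMapChain.map_run (2 * D.M) D.sweepMoves (fun _ => D.measurable_moveStep _)
    (fun t : Fin (2 * D.M + 1) => prodBernoulli (D.stage (-(D.M : ℤ) + t))) fun t => ?_
  · simp only [Fin.val_zero, Nat.cast_zero, add_zero, Fin.val_last] at h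
    push_cast at h
    rw [show -(D.M : ℤ) + 2 * (D.M : ℤ) = D.M by ring] at h
    exact h
  · have h1 : (-(D.M : ℤ) + ((t.succ : Fin (2 * D.M + 1)) : ℕ)) = -(D.M : ℤ) + t + 1 := by
      rw [Fin.val_succ]; push_cast; ring
    rw [Fin.val_castSucc, h1]
    exact map_moveStep hV (by omega) (by have := t.2; omega)

/-! ### Insertion and removal of the travelling rhombus -/

variable (D)

/-- **Insertion** of the green rhombus at the left side, its edge sampled from the uniform
variable `u` "with the distribution appropriate to the isoradial embedding": in the odd case the
new edge `B_{-M}T_{-M}` (weight `p_{π-(β_j-β_{j-1})}`), in the even case — after renaming the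
boundary vertex `O_{-M}` to `⋆` — the pendant edge `⋆N_{-M}` (weight `p_{β_j-β_{j-1}}`).
[cite: GrimmettManolescu2014Isoradial, §5.3] -/
def insertStep (ω : Set (Sym2 SV)) (u : unitInterval) : Set (Sym2 SV) :=
  if Even (-(D.M : ℤ) + D.j) then
    resample s(none, D.mid (-(D.M : ℤ))) (angleWeight (D.up - D.lo)) (sym2Equiv (D.swapMid (-(D.M : ℤ))) '' ω) u
  else resample s(D.bot (-(D.M : ℤ)), D.top (-(D.M : ℤ))) (angleWeight (π - (D.up - D.lo))) ω u

/-- **Removal** of the travelling rhombus at the right side: its last edge is deleted.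
[cite: GrimmettManolescu2014Isoradial, §5.3] -/
def removeStep (ω : Set (Sym2 SV)) : Set (Sym2 SV) :=
  if Even ((D.M : ℤ) + D.j) then ω \ {s(none, D.mid D.M)} else ω \ {s(D.bot D.M, D.top D.M)}

/-- Insertion is jointly measurable. [folklore] -/
theorem measurable_insertStep : Measurable (Function.uncurry D.insertStep) := by
  unfold insertStep
  split_ifs
  · exact (measurable_resample _ _).comp
      (((measurable_image_equiv _).comp measurable_fst).prodMk measurable_snd)
  · exact measurable_resample _ _

/-- Removal is measurable. [folklore] -/
theorem measurable_removeStep : Measurable D.removeStep := by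
  unfold removeStep
  split_ifs <;> exact measurable_sdiff_const _

/-- Swapping twice is the identity on pairs. [folklore] -/
theorem sym2Map_swapMid_swapMid (i : ℤ) (e : Sym2 SV) :
    Sym2.map (D.swapMid i) (Sym2.map (D.swapMid i) e) = e := by
  rw [Sym2.map_map]
  have h : ((D.swapMid i) ∘ (D.swapMid i) : SV → SV) = id := by
    funext x; exact Equiv.swap_apply_self _ _ _
  rw [h, Sym2.map_id, id]

variable {D}

/-- **The law after insertion** is the law of the first stage: `P_{initial} ⊗ U ↦ P_{stage (-M)}`
(`oddStage_neg`, `evenStage_neg`, `map_resample`). [cite: GrimmettManolescu2014Isoradial, §5.3] -/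
theorem map_insertStep :
    ((prodBernoulli D.initial).prod (volume : Measure unitInterval)).map (Function.uncurry D.insertStep) =
      prodBernoulli (D.stage (-(D.M : ℤ))) := by
  unfold insertStep stage
  by_cases hpar : Even (-(D.M : ℤ) + D.j)
  · simp only [hpar, if_true]
    have h1 : (Function.uncurry fun ω u =>
        resample s(none, D.mid (-(D.M : ℤ))) (angleWeight (D.up - D.lo)) (sym2Equiv (D.swapMid (-(D.M : ℤ))) '' ω) u) =
        (fun x : Set (Sym2 SV) × unitInterval => resample s(none, D.mid (-(D.M : ℤ))) (angleWeight (D.up - D.lo)) x.1 x.2) ∘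
          Prod.map (fun ω => sym2Equiv (D.swapMid (-(D.M : ℤ))) '' ω) id := rfl
    rw [h1, ← Measure.map_map (measurable_resample _ _) ((measurable_image_equiv _).prodMap measurable_id),
      ← Measure.map_prod_map _ _ (measurable_image_equiv _) measurable_id, Measure.map_id,
      prodBernoulli_map_image_of_comp_eq D.initial (D.initial ∘ Sym2.map (D.swapMid (-(D.M : ℤ))))
        (sym2Equiv (D.swapMid (-(D.M : ℤ)))) (fun e => by simp [sym2Map_swapMid_swapMid]),
      map_resample, evenStage_neg hpar]
  · simp only [hpar, if_false]
    rw [show (Function.uncurry fun ω u =>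
        resample s(D.bot (-(D.M : ℤ)), D.top (-(D.M : ℤ))) (angleWeight (π - (D.up - D.lo))) ω u) =
        fun x : Set (Sym2 SV) × unitInterval =>
          resample s(D.bot (-(D.M : ℤ)), D.top (-(D.M : ℤ))) (angleWeight (π - (D.up - D.lo))) x.1 x.2 from rfl,
      map_resample, oddStage_neg]

/-- **The law after removal** is the canonical measure of the exchanged lattice:
`P_{stage M} ↦ P_{exchanged}` (`update_oddStage_M`, `update_evenStage_M`).
[cite: GrimmettManolescu2014Isoradial, §5.3] -/
theorem map_removeStep :
    (prodBernoulli (D.stage D.M)).map D.removeStep = prodBernoulli D.exchanged := by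
  classical
  unfold removeStep stage
  by_cases hpar : Even ((D.M : ℤ) + D.j)
  · simp only [hpar, if_true]
    rw [prodBernoulli_map_sdiff_singleton, update_evenStage_M]
  · simp only [hpar, if_false]
    rw [prodBernoulli_map_sdiff_singleton, update_oddStage_M]

/-! ### The sweep `Σ_j` -/

variable (D)

/-- **The track exchange `Σ_j` on configurations of the strip**, driven by one uniform variable
for the green edge and `2M` for the star–triangle transformations: insertion, sliding, removal.
[cite: GrimmettManolescu2014Isoradial, §5.3] -/
def sweep (ω : Set (Sym2 SV)) (r : unitInterval × (Fin (2 * D.M) → unitInterval)) : Set (Sym2 SV) :=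
  D.removeStep (D.slide (D.insertStep ω r.1) r.2)

/-- The randomness driving one sweep: `1 + 2M` independent uniform variables. [folklore] -/
def sweepNoise : Measure (unitInterval × (Fin (2 * D.M) → unitInterval)) :=
  (volume : Measure unitInterval).prod (Measure.pi fun _ : Fin (2 * D.M) => (volume : Measure unitInterval))

/-- The noise of one sweep is a probability measure. [folklore] -/
instance : IsProbabilityMeasure D.sweepNoise := by
  unfold sweepNoise; infer_instance

/-- The sweep is jointly measurable. [folklore] -/
theorem measurable_sweep : Measurable (Function.uncurry D.sweep) := by
  refine D.measurable_removeStep.comp (D.measurable_slide.comp (Measurable.prodMk ?_ ?_))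
  · exact D.measurable_insertStep.comp (measurable_fst.prodMk (measurable_fst.comp measurable_snd))
  · exact measurable_snd.comp measurable_snd

variable {D}

/-- **`Σ_j(G_{α,β}, P_{α,β}) = (G_{α,σ_jβ}, P_{α,σ_jβ})`**: fed with `P_{α,β}` on the strip and
independent uniform variables, the sweep outputs a configuration of law `P_{α,σ_jβ}` on the
strip. [cite: GrimmettManolescu2014Isoradial, §5.3] -/
theorem map_sweep (hV : D.Valid) :
    ((prodBernoulli D.initial).prod D.sweepNoise).map (Function.uncurry D.sweep) = prodBernoulli D.exchanged := by
  -- reassociate the randomness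
  have hfac : Function.uncurry D.sweep =
      (D.removeStep ∘ (fun y : Set (Sym2 SV) × (Fin (2 * D.M) → unitInterval) => D.slide y.1 y.2) ∘
        Prod.map (Function.uncurry D.insertStep) id) ∘
        (MeasurableEquiv.prodAssoc : (Set (Sym2 SV) × unitInterval) × (Fin (2 * D.M) → unitInterval) ≃ᵐ _).symm := by
    funext x; rfl
  have hm : Measurable (D.removeStep ∘ (fun y : Set (Sym2 SV) × (Fin (2 * D.M) → unitInterval) => D.slide y.1 y.2) ∘
      Prod.map (Function.uncurry D.insertStep) id) :=
    D.measurable_removeStep.comp (D.measurable_slide.comp (D.measurable_insertStep.prodMap measurable_id))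
  rw [hfac, ← Measure.map_map hm (MeasurableEquiv.measurable _), sweepNoise, ← Measure.prodAssoc_prod,
    MeasurableEquiv.map_symm_map, ← Measure.map_map D.measurable_removeStep
      (D.measurable_slide.comp (D.measurable_insertStep.prodMap measurable_id)),
    ← Measure.map_map D.measurable_slide (D.measurable_insertStep.prodMap measurable_id),
    ← Measure.map_prod_map _ _ D.measurable_insertStep measurable_id, Measure.map_id, map_insertStep,
    map_slide hV, map_removeStep]

end ExchangeData

end TrackExchange

end Literature.Probability.Percolation
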